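import Summits.Parity.GeneralizedHardyLittlewood.Theorems.LeeYangFibresRelativeDimOneMoebiusSplitStubDefs
import Summits.Parity.GeneralizedHardyLittlewood.Theorems.LeeYangFibresRelativeDimOneMoebiusSplitSingularSeriesAux5
import HarnessLib

/-!
# Crux `RelativeDimOne` (stmt-Parity-14113), line `single-moebius-split`, stub `stub_tssInduction`:
# auxiliary file 6 — the local factors of the conditioned data

Induction step `t → t + 1` of `TSSInduction` (general local data given by windows `W_p` and root sets
`Z_{p,i}`), part 1: pure finite bookkeeping at one prime `p`.

* `TSSInd.gyWeight_cond`, `tssI_gySum_peel` (registered): peeling the last Möbius variable `x` of the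
  `(t+1)`-variable sum (`tss_gy_peel`) yields the `t`-variable sum of the CONDITIONED data
  `W^{(x)}_p = W_p ∩ Z_{p,t}` (`p ∣ x`), `W_p` (`p ∤ x`), with the first `t` root sets;
* `TSSInd.gyLocalFactor_cond`, `TSSInd.gyLocalFactor_succ`: the local factors of the conditioned data are
  `A_p` (`p ∣ x`) and `B_p` (`p ∤ x`), and `β^{t+1}_p(W, Z) = (p/(p−1)) (B_p − A_p)`;
* sizes: `0 ≤ β ≤ (p/(p−1))^t |W_p|/p`; at an unconditioned prime (full window, `≤ 1` root per form,
  `p > 2(t+1)`) `B_p ≥ (p/(p−1))^t (p−t)/p > 0`, `A_p ≤ (p/(p−1))^t/p`; at a generic prime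
  `B_p = (p/(p−1))^t (p−t)/p ≤ 1` and `A_p = (p/(p−1))^t/p`, so that the twist `w(p) = A_p/B_p` has
  `p w(p) = p/(p−t)`.

References: D. A. Goldston, C. Y. Yıldırım, Integers 3 (2003) A5 = arXiv:math/0111212, §2–3 [GoldstonYildirim2001];
B. Green, T. Tao, Ann. of Math. 171 (2010), App. D [GreenTao2010].
-/

noncomputable section

open Finset Real
open scoped BigOperators

namespace Summit.Parity.GeneralizedHardyLittlewood.Cruxes.RelativeDimOne.SingleMoebiusSplit

namespace TSSInd

/-! ### The weights of the conditioned data -/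

/-- The weight of the original data at the pattern `ι S ∪ {t}·[p ∣ x]` is the weight of the data conditioned
on `x` (window `W_p ∩ Z_{p,t}` at `p ∣ x`) at the pattern `S`. [folklore] -/
theorem gyWeight_cond {t : ℕ} (W : ℕ → Finset ℕ) (Z : ℕ → Fin (t + 1) → Finset ℕ) (p x : ℕ)
    (S : Finset (Fin t)) :
    gyWeight W Z p (if p ∣ x then insert (Fin.last t) (S.map Fin.castSuccEmb) else S.map Fin.castSuccEmb) =
      gyWeight (fun q => if q ∣ x then (W q).filter (fun r => r ∈ Z q (Fin.last t)) else W q)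
        (fun q i => Z q (Fin.castSucc i)) p S := by
  unfold gyWeight
  dsimp only
  by_cases hx : p ∣ x
  · rw [if_pos hx, if_pos hx, Finset.filter_filter]
    have h : ((W p).filter fun r => ∀ i ∈ insert (Fin.last t) (S.map Fin.castSuccEmb), r ∈ Z p i) =
        (W p).filter fun r => r ∈ Z p (Fin.last t) ∧ ∀ i ∈ S, r ∈ Z p (Fin.castSucc i) := by
      refine Finset.filter_congr fun r _ => ?_
      simp only [Finset.forall_mem_insert, Finset.forall_mem_map, Fin.castSuccEmb_apply]
    rw [h]
  · rw [if_neg hx, if_neg hx]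
    have h : ((W p).filter fun r => ∀ i ∈ S.map Fin.castSuccEmb, r ∈ Z p i) =
        (W p).filter fun r => ∀ i ∈ S, r ∈ Z p (Fin.castSucc i) := by
      refine Finset.filter_congr fun r _ => ?_
      simp only [Finset.forall_mem_map, Fin.castSuccEmb_apply]
    rw [h]

/-! ### The local factors of the conditioned data -/

/-- The local factor of the data conditioned on `x` is `A_p` if `p ∣ x` and `B_p` if `p ∤ x`. [folklore] -/
theorem gyLocalFactor_cond {t : ℕ} (W : ℕ → Finset ℕ) (Z : ℕ → Fin (t + 1) → Finset ℕ) (p x : ℕ) :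
    gyLocalFactor (fun q => if q ∣ x then (W q).filter (fun r => r ∈ Z q (Fin.last t)) else W q)
        (fun q i => Z q (Fin.castSucc i)) p =
      if p ∣ x then
        gyLocalFactor (fun q => (W q).filter (fun r => r ∈ Z q (Fin.last t))) (fun q i => Z q (Fin.castSucc i)) p
      else gyLocalFactor W (fun q i => Z q (Fin.castSucc i)) p := by
  unfold gyLocalFactor
  dsimp only
  by_cases hx : p ∣ x
  · rw [if_pos hx, if_pos hx]
  · rw [if_neg hx, if_neg hx]

/-- **Key identity** `β^{t+1}_p(W, Z) = (p/(p−1)) (B_p − A_p)`: the residues avoiding all `t + 1` root sets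
are those avoiding the first `t` minus those of them lying in `Z_{p,t}`. [folklore] -/
theorem gyLocalFactor_succ {t : ℕ} (W : ℕ → Finset ℕ) (Z : ℕ → Fin (t + 1) → Finset ℕ) (p : ℕ) :
    gyLocalFactor W Z p = (p : ℝ) / ((p : ℝ) - 1) *
      (gyLocalFactor W (fun q i => Z q (Fin.castSucc i)) p -
        gyLocalFactor (fun q => (W q).filter (fun r => r ∈ Z q (Fin.last t)))
          (fun q i => Z q (Fin.castSucc i)) p) := by
  unfold gyLocalFactor
  have h1 : ((W p).filter fun r => ∀ i : Fin (t + 1), r ∉ Z p i) =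
      ((W p).filter fun r => ∀ i : Fin t, r ∉ Z p (Fin.castSucc i)).filter
        (fun r => r ∉ Z p (Fin.last t)) := by
    rw [Finset.filter_filter]
    refine Finset.filter_congr fun r _ => ?_
    rw [Fin.forall_fin_succ']
  have h2 : (((W p).filter fun r => r ∈ Z p (Fin.last t)).filter
      fun r => ∀ i : Fin t, r ∉ Z p (Fin.castSucc i)) =
      ((W p).filter fun r => ∀ i : Fin t, r ∉ Z p (Fin.castSucc i)).filter
        (fun r => r ∈ Z p (Fin.last t)) := by
    rw [Finset.filter_filter, Finset.filter_filter]
    exact Finset.filter_congr fun r _ => and_comm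
  have hcard : ((((W p).filter fun r => ∀ i : Fin (t + 1), r ∉ Z p i).card : ℕ) : ℝ) =
      ((((W p).filter fun r => ∀ i : Fin t, r ∉ Z p (Fin.castSucc i)).card : ℕ) : ℝ) -
        (((((W p).filter fun r => r ∈ Z p (Fin.last t)).filter
          fun r => ∀ i : Fin t, r ∉ Z p (Fin.castSucc i)).card : ℕ) : ℝ) := by
    rw [eq_sub_iff_add_eq, h1, h2, add_comm]
    exact_mod_cast Finset.card_filter_add_card_filter_not
      (s := (W p).filter fun r => ∀ i : Fin t, r ∉ Z p (Fin.castSucc i)) (fun r => r ∈ Z p (Fin.last t))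
  rw [hcard, pow_succ]
  ring

/-! ### Sizes of local factors -/

/-- `0 ≤ p/(p−1)` for every natural `p` (the value is `0` at `p = 0, 1`). [folklore] -/
theorem div_pred_nonneg (p : ℕ) : (0 : ℝ) ≤ (p : ℝ) / ((p : ℝ) - 1) := by
  rcases Nat.lt_or_ge p 1 with h | h
  · have hp : p = 0 := by omega
    subst hp
    simp
  · have h1 : (1 : ℝ) ≤ p := by exact_mod_cast h
    exact div_nonneg (Nat.cast_nonneg p) (by linarith)

/-- `(p/(p−1))^t ≤ 2^t` for `p ≥ 2`. [folklore] -/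
theorem div_pred_pow_le_two_pow {p : ℕ} (hp : 2 ≤ p) (t : ℕ) :
    ((p : ℝ) / ((p : ℝ) - 1)) ^ t ≤ 2 ^ t := by
  have hp2 : (2 : ℝ) ≤ p := by exact_mod_cast hp
  refine pow_le_pow_left₀ (div_pred_nonneg p) ?_ t
  rw [div_le_iff₀ (by linarith)]
  linarith

/-- `0 ≤ β_p(W, Z)`. [folklore] -/
theorem gyLocalFactor_nonneg {t : ℕ} (W : ℕ → Finset ℕ) (Z : ℕ → Fin t → Finset ℕ) (p : ℕ) :
    0 ≤ gyLocalFactor W Z p := by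
  unfold gyLocalFactor
  exact mul_nonneg (pow_nonneg (div_pred_nonneg p) _) (div_nonneg (Nat.cast_nonneg _) (Nat.cast_nonneg _))

/-- `β_p(W, Z) ≤ (p/(p−1))^t |W_p|/p`. [folklore] -/
theorem gyLocalFactor_le {t : ℕ} (W : ℕ → Finset ℕ) (Z : ℕ → Fin t → Finset ℕ) (p : ℕ) :
    gyLocalFactor W Z p ≤ ((p : ℝ) / ((p : ℝ) - 1)) ^ t * ((((W p).card : ℕ) : ℝ) / p) := by
  unfold gyLocalFactor
  refine mul_le_mul_of_nonneg_left ?_ (pow_nonneg (div_pred_nonneg p) _)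
  exact div_le_div_of_nonneg_right (by exact_mod_cast Finset.card_filter_le _ _) (Nat.cast_nonneg _)

/-- `|A_p| + |B_p| ≤ 2^{t+1} |W_p|/p` for `p ≥ 2`. [folklore] -/
theorem abs_add_abs_le {t : ℕ} (W : ℕ → Finset ℕ) (Z : ℕ → Fin (t + 1) → Finset ℕ) {p : ℕ} (hp : 2 ≤ p) :
    |gyLocalFactor (fun q => (W q).filter (fun r => r ∈ Z q (Fin.last t))) (fun q i => Z q (Fin.castSucc i)) p| +
        |gyLocalFactor W (fun q i => Z q (Fin.castSucc i)) p| ≤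
      2 ^ (t + 1) * ((((W p).card : ℕ) : ℝ) / p) := by
  rw [abs_of_nonneg (gyLocalFactor_nonneg _ _ _), abs_of_nonneg (gyLocalFactor_nonneg _ _ _)]
  have hW : 0 ≤ (((W p).card : ℕ) : ℝ) / p := div_nonneg (Nat.cast_nonneg _) (Nat.cast_nonneg _)
  have h2 := div_pred_pow_le_two_pow hp t
  have hA := gyLocalFactor_le (fun q => (W q).filter (fun r => r ∈ Z q (Fin.last t)))
    (fun q i => Z q (Fin.castSucc i)) p
  have hB := gyLocalFactor_le W (fun q i => Z q (Fin.castSucc i)) p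
  have hfil : ((((W p).filter (fun r => r ∈ Z p (Fin.last t))).card : ℕ) : ℝ) / p ≤ (((W p).card : ℕ) : ℝ) / p :=
    div_le_div_of_nonneg_right (by exact_mod_cast Finset.card_filter_le _ _) (Nat.cast_nonneg _)
  have hA' : gyLocalFactor (fun q => (W q).filter (fun r => r ∈ Z q (Fin.last t)))
      (fun q i => Z q (Fin.castSucc i)) p ≤ 2 ^ t * ((((W p).card : ℕ) : ℝ) / p) :=
    hA.trans (mul_le_mul h2 hfil (div_nonneg (Nat.cast_nonneg _) (Nat.cast_nonneg _)) (by positivity))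
  have hB' : gyLocalFactor W (fun q i => Z q (Fin.castSucc i)) p ≤ 2 ^ t * ((((W p).card : ℕ) : ℝ) / p) :=
    hB.trans (mul_le_mul_of_nonneg_right h2 hW)
  rw [pow_succ]
  linarith

/-! ### Counting residues off the root sets -/

/-- If each of `t` root sets has at most one element, at least `p − t` residues of `{0, …, p−1}` avoid all of
them. [folklore] -/
theorem sub_le_card_filter_forall_notMem {t p : ℕ} (Zp : Fin t → Finset ℕ) (hZ : ∀ i, (Zp i).card ≤ 1) :
    p - t ≤ ((Finset.range p).filter fun r => ∀ i, r ∉ Zp i).card := by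
  classical
  have hsub : Finset.range p \ Finset.univ.biUnion Zp ⊆ (Finset.range p).filter fun r => ∀ i, r ∉ Zp i := by
    intro r hr
    rw [Finset.mem_sdiff, Finset.mem_biUnion] at hr
    exact Finset.mem_filter.2 ⟨hr.1, fun i hi => hr.2 ⟨i, Finset.mem_univ i, hi⟩⟩
  have hU : (Finset.univ.biUnion Zp).card ≤ t := by
    refine Finset.card_biUnion_le.trans ?_
    calc ∑ i, (Zp i).card ≤ ∑ _i : Fin t, 1 := Finset.sum_le_sum fun i _ => hZ i
      _ = t := by simp
  calc p - t ≤ (Finset.range p).card - (Finset.univ.biUnion Zp).card := by rw [Finset.card_range]; omega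
    _ ≤ (Finset.range p \ Finset.univ.biUnion Zp).card := Finset.le_card_sdiff _ _
    _ ≤ _ := Finset.card_le_card hsub

/-- GENERIC root data (`Z_{p,i} = {r_i}`, `r_i < p` pairwise distinct, `i ≤ t`): exactly `p − t` residues avoid
the first `t` root sets, and `r_t` is a residue of `Z_{p,t}` avoiding them. [folklore] -/
theorem card_filter_generic {t p : ℕ} (Zp : Fin (t + 1) → Finset ℕ)
    (hgen : ∀ i : Fin (t + 1), ∃ r : ℕ, r < p ∧ Zp i = {r} ∧ ∀ j : Fin (t + 1), j ≠ i → r ∉ Zp j) :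
    ((Finset.range p).filter fun r => ∀ i : Fin t, r ∉ Zp (Fin.castSucc i)).card = p - t ∧
      1 ≤ (((Finset.range p).filter fun r => r ∈ Zp (Fin.last t)).filter
        fun r => ∀ i : Fin t, r ∉ Zp (Fin.castSucc i)).card := by
  classical
  choose r hr hZ hne using hgen
  refine ⟨?_, ?_⟩
  · have hU : ((Finset.range p).filter fun s => ∀ i : Fin t, s ∉ Zp (Fin.castSucc i)) =
        Finset.range p \ Finset.univ.image (fun i : Fin t => r (Fin.castSucc i)) := by
      ext s
      simp only [Finset.mem_filter, Finset.mem_sdiff, Finset.mem_image, Finset.mem_univ, true_and, not_exists]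
      refine and_congr_right fun _ => forall_congr' fun i => ?_
      rw [hZ (Fin.castSucc i), Finset.mem_singleton]
      exact ⟨fun h h' => h h'.symm, fun h h' => h h'.symm⟩
    have hinj : Function.Injective fun i : Fin t => r (Fin.castSucc i) := by
      intro i j hij
      by_contra hne'
      have h1 : Fin.castSucc j ≠ Fin.castSucc i := fun h => hne' (Fin.castSucc_injective _ h).symm
      have h2 := hne (Fin.castSucc i) (Fin.castSucc j) h1
      rw [hZ (Fin.castSucc j), Finset.mem_singleton] at h2
      exact h2 hij
    have hsub : Finset.univ.image (fun i : Fin t => r (Fin.castSucc i)) ⊆ Finset.range p := by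
      intro s hs
      obtain ⟨i, -, rfl⟩ := Finset.mem_image.1 hs
      exact Finset.mem_range.2 (hr _)
    rw [hU, Finset.card_sdiff_of_subset hsub, Finset.card_image_of_injective _ hinj, Finset.card_range,
      Finset.card_univ, Fintype.card_fin]
  · refine Finset.card_pos.2 ⟨r (Fin.last t), ?_⟩
    simp only [Finset.mem_filter, Finset.mem_range]
    refine ⟨⟨hr _, ?_⟩, fun i => hne (Fin.last t) (Fin.castSucc i) (Fin.castSucc_lt_last i).ne⟩
    rw [hZ (Fin.last t)]
    exact Finset.mem_singleton_self _

/-! ### The local factors at an unconditioned prime -/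

/-- At a prime with full window and at most one root per form (`p > t`):
`B_p ≥ (p/(p−1))^t (p − t)/p`. [folklore] -/
theorem B_ge {t p : ℕ} (W : ℕ → Finset ℕ) (Z : ℕ → Fin (t + 1) → Finset ℕ) (hW : W p = Finset.range p)
    (htp : t < p) (hZ : ∀ i, (Z p i).card ≤ 1) :
    ((p : ℝ) / ((p : ℝ) - 1)) ^ t * (((p : ℝ) - t) / p) ≤ gyLocalFactor W (fun q i => Z q (Fin.castSucc i)) p := by
  unfold gyLocalFactor
  refine mul_le_mul_of_nonneg_left ?_ (pow_nonneg (div_pred_nonneg p) _)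
  refine div_le_div_of_nonneg_right ?_ (Nat.cast_nonneg _)
  have h := sub_le_card_filter_forall_notMem (p := p) (fun i : Fin t => Z p (Fin.castSucc i))
    (fun i => hZ (Fin.castSucc i))
  rw [hW]
  have h' : ((p - t : ℕ) : ℝ) ≤ (((Finset.range p).filter fun r => ∀ i : Fin t, r ∉ Z p (Fin.castSucc i)).card : ℕ) := by
    exact_mod_cast h
  rwa [Nat.cast_sub htp.le] at h'

/-- At such a prime `B_p > 0`. [folklore] -/
theorem B_pos {t p : ℕ} (W : ℕ → Finset ℕ) (Z : ℕ → Fin (t + 1) → Finset ℕ) (hW : W p = Finset.range p)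
    (hp : 2 ≤ p) (htp : t < p) (hZ : ∀ i, (Z p i).card ≤ 1) :
    0 < gyLocalFactor W (fun q i => Z q (Fin.castSucc i)) p := by
  refine lt_of_lt_of_le ?_ (B_ge W Z hW htp hZ)
  have hp2 : (2 : ℝ) ≤ p := by exact_mod_cast hp
  have htp' : (t : ℝ) < p := by exact_mod_cast htp
  have h1 : (1 : ℝ) ≤ ((p : ℝ) / ((p : ℝ) - 1)) ^ t := TSSPeel.one_le_div_pred_pow hp t
  have h2 : (0 : ℝ) < ((p : ℝ) - t) / p := div_pos (by linarith) (by linarith)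
  positivity

/-- At such a prime `A_p ≤ (p/(p−1))^t / p` (the conditioned window lies in `Z_{p,t}`). [folklore] -/
theorem A_le {t p : ℕ} (W : ℕ → Finset ℕ) (Z : ℕ → Fin (t + 1) → Finset ℕ) (hZ : (Z p (Fin.last t)).card ≤ 1) :
    gyLocalFactor (fun q => (W q).filter (fun r => r ∈ Z q (Fin.last t))) (fun q i => Z q (Fin.castSucc i)) p ≤
      ((p : ℝ) / ((p : ℝ) - 1)) ^ t * (1 / p) := by
  refine (gyLocalFactor_le _ _ p).trans (mul_le_mul_of_nonneg_left ?_ (pow_nonneg (div_pred_nonneg p) _))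
  refine div_le_div_of_nonneg_right ?_ (Nat.cast_nonneg _)
  have h : ((W p).filter (fun r => r ∈ Z p (Fin.last t))).card ≤ 1 :=
    (Finset.card_le_card (fun r hr => (Finset.mem_filter.1 hr).2)).trans hZ
  exact_mod_cast h

/-- With a full window `B_p ≤ (p/(p−1))^t`. [folklore] -/
theorem B_le {t p : ℕ} (W : ℕ → Finset ℕ) (Z : ℕ → Fin (t + 1) → Finset ℕ) (hW : W p = Finset.range p) :
    gyLocalFactor W (fun q i => Z q (Fin.castSucc i)) p ≤ ((p : ℝ) / ((p : ℝ) - 1)) ^ t := by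
  refine (gyLocalFactor_le _ _ p).trans ?_
  rw [hW, Finset.card_range]
  refine mul_le_of_le_one_right (pow_nonneg (div_pred_nonneg p) _) ?_
  rcases Nat.eq_zero_or_pos p with h | h
  · subst h; simp
  · rw [div_self (by exact_mod_cast h.ne')]

/-! ### The local factors at a generic prime -/

/-- At a GENERIC prime (full window, the `t+1` root sets distinct singletons): `B_p = (p/(p−1))^t (p−t)/p` and
`A_p ≥ (p/(p−1))^t/p`. [folklore] -/
theorem generic_values {t p : ℕ} (W : ℕ → Finset ℕ) (Z : ℕ → Fin (t + 1) → Finset ℕ)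
    (hW : W p = Finset.range p) (htp : t < p)
    (hgen : ∀ i : Fin (t + 1), ∃ r : ℕ, r < p ∧ Z p i = {r} ∧ ∀ j : Fin (t + 1), j ≠ i → r ∉ Z p j) :
    gyLocalFactor W (fun q i => Z q (Fin.castSucc i)) p = ((p : ℝ) / ((p : ℝ) - 1)) ^ t * (((p : ℝ) - t) / p) ∧
      ((p : ℝ) / ((p : ℝ) - 1)) ^ t * (1 / p) ≤
        gyLocalFactor (fun q => (W q).filter (fun r => r ∈ Z q (Fin.last t))) (fun q i => Z q (Fin.castSucc i)) p := by
  obtain ⟨hB, hA⟩ := card_filter_generic (Z p) hgen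
  unfold gyLocalFactor
  dsimp only
  refine ⟨?_, ?_⟩
  · rw [hW, hB, Nat.cast_sub htp.le]
  · refine mul_le_mul_of_nonneg_left ?_ (pow_nonneg (div_pred_nonneg p) _)
    refine div_le_div_of_nonneg_right ?_ (Nat.cast_nonneg _)
    rw [hW]
    exact_mod_cast hA

/-! ### The twist `w(p) = A_p / B_p` -/

/-- ROUGH prime (full window, `≤ 1` root per form, `p > 2t`): `|p · A_p/B_p| ≤ 2`. [folklore] -/
theorem twist_rough {t p : ℕ} (W : ℕ → Finset ℕ) (Z : ℕ → Fin (t + 1) → Finset ℕ) (hW : W p = Finset.range p)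
    (hp : 2 ≤ p) (htp : 2 * t < p) (hZ : ∀ i, (Z p i).card ≤ 1) :
    |(p : ℝ) * (gyLocalFactor (fun q => (W q).filter (fun r => r ∈ Z q (Fin.last t)))
        (fun q i => Z q (Fin.castSucc i)) p / gyLocalFactor W (fun q i => Z q (Fin.castSucc i)) p)| ≤ 2 := by
  have htp1 : t < p := by omega
  have hBpos := B_pos W Z hW hp htp1 hZ
  have hBge := B_ge W Z hW htp1 hZ
  have hAle := A_le W Z (hZ (Fin.last t))
  have hA0 := gyLocalFactor_nonneg (fun q => (W q).filter (fun r => r ∈ Z q (Fin.last t)))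
    (fun q i => Z q (Fin.castSucc i)) p
  set A := gyLocalFactor (fun q => (W q).filter (fun r => r ∈ Z q (Fin.last t))) (fun q i => Z q (Fin.castSucc i)) p
  set B := gyLocalFactor W (fun q i => Z q (Fin.castSucc i)) p
  set θ := ((p : ℝ) / ((p : ℝ) - 1)) ^ t
  have hp2 : (2 : ℝ) ≤ p := by exact_mod_cast hp
  have hp0 : (0 : ℝ) < p := by linarith
  have htp' : 2 * (t : ℝ) < p := by exact_mod_cast htp
  have hθ1 : 1 ≤ θ := TSSPeel.one_le_div_pred_pow hp t
  rw [abs_of_nonneg (mul_nonneg hp0.le (div_nonneg hA0 hBpos.le)), mul_div_assoc', div_le_iff₀ hBpos]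
  -- `p A ≤ θ ≤ 2 θ (p - t)/p ≤ 2 B`
  have h1 : (p : ℝ) * A ≤ θ := by
    calc (p : ℝ) * A ≤ p * (θ * (1 / p)) := mul_le_mul_of_nonneg_left hAle hp0.le
      _ = θ := by field_simp
  have h2 : θ ≤ 2 * (θ * (((p : ℝ) - t) / p)) := by
    rw [show 2 * (θ * (((p : ℝ) - t) / p)) = θ * (2 * ((p : ℝ) - t) / p) by ring]
    refine le_mul_of_one_le_right (by linarith) ?_
    rw [le_div_iff₀ hp0]
    linarith
  linarith [mul_le_mul_of_nonneg_left hBge (by norm_num : (0 : ℝ) ≤ 2)]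

/-- GENERIC prime (`p > 2t + 2`): `|p · A_p/B_p − 1| ≤ (2t + 2)/p` (indeed `p A_p/B_p = p/(p−t)`). [folklore] -/
theorem twist_generic {t p : ℕ} (W : ℕ → Finset ℕ) (Z : ℕ → Fin (t + 1) → Finset ℕ) (hW : W p = Finset.range p)
    (hp : 2 ≤ p) (htp : 2 * (t + 1) < p) (hZ : ∀ i, (Z p i).card ≤ 1)
    (hgen : ∀ i : Fin (t + 1), ∃ r : ℕ, r < p ∧ Z p i = {r} ∧ ∀ j : Fin (t + 1), j ≠ i → r ∉ Z p j) :
    |(p : ℝ) * (gyLocalFactor (fun q => (W q).filter (fun r => r ∈ Z q (Fin.last t)))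
        (fun q i => Z q (Fin.castSucc i)) p / gyLocalFactor W (fun q i => Z q (Fin.castSucc i)) p) - 1| ≤
      ((2 * t + 2 : ℕ) : ℝ) / p := by
  have htp1 : t < p := by omega
  have hBpos := B_pos W Z hW hp htp1 hZ
  obtain ⟨hBeq, hAge⟩ := generic_values W Z hW htp1 hgen
  have hAle := A_le W Z (hZ (Fin.last t))
  set A := gyLocalFactor (fun q => (W q).filter (fun r => r ∈ Z q (Fin.last t))) (fun q i => Z q (Fin.castSucc i)) p
  set B := gyLocalFactor W (fun q i => Z q (Fin.castSucc i)) p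
  set θ := ((p : ℝ) / ((p : ℝ) - 1)) ^ t
  have hp2 : (2 : ℝ) ≤ p := by exact_mod_cast hp
  have hp0 : (0 : ℝ) < p := by linarith
  have htp' : 2 * ((t : ℝ) + 1) < p := by exact_mod_cast htp
  have hθ1 : 1 ≤ θ := TSSPeel.one_le_div_pred_pow hp t
  have hθ0 : 0 < θ := by linarith
  have hAeq : A = θ * (1 / p) := le_antisymm hAle hAge
  have hpt0 : (0 : ℝ) < (p : ℝ) - t := by linarith
  have hw : (p : ℝ) * (A / B) = p / ((p : ℝ) - t) := by
    rw [hAeq, hBeq]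
    field_simp
  rw [hw]
  have heq : (p : ℝ) / ((p : ℝ) - t) - 1 = t / ((p : ℝ) - t) := by
    field_simp
    ring
  rw [heq, abs_of_nonneg (div_nonneg (Nat.cast_nonneg t) hpt0.le), div_le_div_iff₀ hpt0 hp0]
  push_cast
  nlinarith

/-- GENERIC prime: `0 ≤ B_p ≤ 1` (Bernoulli). [folklore] -/
theorem B_le_one_generic {t p : ℕ} (W : ℕ → Finset ℕ) (Z : ℕ → Fin (t + 1) → Finset ℕ)
    (hW : W p = Finset.range p) (hp : 2 ≤ p) (htp : t < p)
    (hgen : ∀ i : Fin (t + 1), ∃ r : ℕ, r < p ∧ Z p i = {r} ∧ ∀ j : Fin (t + 1), j ≠ i → r ∉ Z p j) :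
    gyLocalFactor W (fun q i => Z q (Fin.castSucc i)) p ≤ 1 := by
  obtain ⟨hBeq, -⟩ := generic_values W Z hW htp hgen
  rw [hBeq]
  have hp0 : (0 : ℝ) < p := by have : (2 : ℝ) ≤ p := by exact_mod_cast hp
                               linarith
  have : ((p : ℝ) - t) / p = 1 - t / p := by field_simp
  rw [this]
  exact (TSSPeel.div_pred_pow_mul_bounds hp htp).2

end TSSInd

/-! ### The registered sub-goal of this file: peeling with window/root data -/

open TSSInd in
/-- **Peeling the last variable, window/root form** (sub-goal `tssI_gySum_peel` of `stub_tssInduction`):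
`GY_{t+1}(R, g_{W,Z}; y) = ∑_{x ≤ R_t} μ(x) log(R_t/x) · GY_t(R', g_{W^{(x)}, Z'}; y)` with the conditioned
windows `W^{(x)}_p = W_p ∩ Z_{p,t}` (`p ∣ x`), `W_p` (`p ∤ x`) and the first `t` root sets `Z'`. [folklore] -/
theorem tssI_gySum_peel : ∀ (t : ℕ) (W : ℕ → Finset ℕ) (Z : ℕ → Fin (t + 1) → Finset ℕ)
    (R : Fin (t + 1) → ℝ) (y : ℕ),
    gySum R (gyWeight W Z) y =
      ∑ x ∈ Finset.Icc 1 ⌊R (Fin.last t)⌋₊, ((ArithmeticFunction.moebius x : ℤ) : ℝ) *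
        Real.log (R (Fin.last t) / x) *
          gySum (fun i => R (Fin.castSucc i))
            (gyWeight (fun q => if q ∣ x then (W q).filter (fun r => r ∈ Z q (Fin.last t)) else W q)
              (fun q i => Z q (Fin.castSucc i))) y := by
  intro t W Z R y
  unfold gySum
  rw [tss_gy_peel t R (gyWeight W Z) y]
  refine Finset.sum_congr rfl fun x _ => ?_
  congr 1
  refine Finset.sum_congr rfl fun d _ => ?_
  congr 1
  exact Finset.prod_congr rfl fun p _ => gyWeight_cond W Z p x _

end Summit.Parity.GeneralizedHardyLittlewood.Cruxes.RelativeDimOne.SingleMoebiusSplit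

end
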